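import Summits.Parity.BatemanHorn.Theorems.BalancedSemiprimeLayer.Negative.HigherLayerNecessary
import Summits.Parity.BatemanHorn.Theorems.RoughValueTransportBalancedSemiprimeLayerRoughWindowLever
import Summits.Parity.BatemanHorn.Theorems.RoughValueTransportBalancedSemiprimeLayerSplit
import HarnessLib

/-!
# `BalancedSemiprimeLayer` — the constant-window consequence (crux stmt-Parity-9469, line
`smooth-modulus-twisted-hooley`, lead seat c14)

A NECESSARY consequence of the residual stub `stub_higherLayer` (= `LayerHigher`, crux-equivalent by
`stub_transfer` p78616 / `Negative.higherLayer_of_balancedSemiprimeLayer` p75295), isolating the weakest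
member of the family of statements the crux makes about one coordinate: semiprime values that are balanced
up to a CONSTANT factor.  For a family `f` with positive leading coefficients and degrees `≥ 1`, a
coordinate `i` with `CoordLayerThin f i`, and any `C ≥ 1`:

  `#{1 ≤ n ≤ x : f_j(n) prime for j ≠ i, f_i(n) = p·q with p ≤ q ≤ C·p primes} ≤ ε·x/(log x)^k`

eventually, for every `ε > 0` (`constantWindow_thin_of_coordLayerThin`); from the crux BY NAME for every
Bateman–Horn system (`constantWindow_thin_of_balancedSemiprimeLayer`); from the registered residual stub
`stub_higherLayer` (= `LayerHigher`) verbatim (`constantWindow_thin_of_higherLayer`); and UNCONDITIONALLY for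
coordinates of degree `≤ 2` (`constantWindow_thin_of_natDegree_le_two`, through the landed
`Split.coordLayerThin_of_natDegree_le_two`, p83112) — e.g. `#{n ≤ x : n² + 1 = p·q, p ≤ q ≤ C·p} = o(x/log x)`
and `#{p ≤ x prime : p + 2 = q₁q₂, q₁ ≤ q₂ ≤ C·q₁} = o(x/(log x)²)`.  Proof: for
`n ≥ 2C·x^{1−δ}` (and `n` past the growth threshold `n^{deg} ≤ 2 f_j(n)` of every coordinate) such an `n`
lies in the layer `coordLayer f i δ x` — the balanced prime `p` satisfies `p² ≥ f_i(n)/C ≥ x^{dᵢ(1−δ)}`, and a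
prime value `f_j(n) ≥ x^{d_j(1−δ)}` is rough at level `x^{d_j(1−δ)/2}` — while the small `n` are
`O(x^{1−δ}) = o(x/(log x)^k)`.

The file also proves the registered bookkeeping stub `stub_constantWindowOfHigherLayer` (LayerHigher, as a
hypothesis, ⟹ the constant-window bound for every coordinate of every Bateman–Horn system).

Purpose (census remark (d) of `Cruxes/BalancedSemiprimeLayer/Lines/smooth-modulus-twisted-hooley-c14.md`):
the constant-window count carries NO `δ → 0` uniformity, its random-model size is `≍ (log C)·x/(log x)^{k+1}`,
and yet no input in the tree or in print bounds it below the `k`-dimensional sieve bound `O(x/(log x)^k)` once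
`deg f_i ≥ 3` (its only certificate is a prime factor in `[√(f_i(n)/C), √f_i(n)]`, a modulus `≍ x^{dᵢ/2}`
against `x` terms).  So the wall recorded for `LayerHigher` is the balanced event itself, not the uniformity in
`δ`; a future milestone can be tested on this statement first.
-/

noncomputable section

namespace Summit.Parity.BatemanHorn.Cruxes.BalancedSemiprimeLayer.SmoothModulusTwistedHooley.ConstantWindow

open Polynomial Filter Finset
open scoped Classical
open Literature.NumberTheory.Sieve
open Summit.Parity.BatemanHorn.Theses.RoughValueTransport (BalancedSemiprimeLayer)
open Summit.Parity.BatemanHorn.Theorems.BalancedSemiprimeLayer.Negative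
  (exists_pow_le_two_mul_eval coordLayerThin_of_balancedSemiprimeLayer
    natDegree_pos_of_isBatemanHornSystem)
open Summit.Parity.BatemanHorn.Cruxes.BalancedSemiprimeLayer.RoughRelaxedDivisorSieve
  (eventually_const_add_rpow_le)

/-- A growth threshold uniform over the coordinates: past some `M`, `n^{deg f_j} ≤ 2 f_j(n)` for every `j`
(from `Negative.exists_pow_le_two_mul_eval`, coordinatewise, and a finite maximum). [folklore] -/
theorem exists_forall_pow_le_two_mul_eval {k : ℕ} (f : Fin k → ℤ[X])
    (hlc : ∀ j, 0 < (f j).leadingCoeff) :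
    ∃ M : ℕ, ∀ j, ∀ n : ℕ, M ≤ n → (n : ℤ) ^ (f j).natDegree ≤ 2 * (f j).eval (n : ℤ) := by
  choose M hM using fun j => exists_pow_le_two_mul_eval (hlc j)
  exact ⟨Finset.univ.sup M, fun j n hn => hM j n (le_trans (Finset.le_sup (mem_univ j)) hn)⟩

/-- The size step: if `n ≥ 2C·x^{1−δ}` and `n^d ≤ 2v` (`d ≥ 1`, `C ≥ 1`), then `C·x^{d(1−δ)} ≤ v`. [folklore] -/
theorem const_mul_rpow_le_of_pow_le {x n d : ℕ} {δ C : ℝ} {v : ℤ} (hd : 1 ≤ d) (hC : 1 ≤ C)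
    (hn : 2 * C * (x : ℝ) ^ (1 - δ) ≤ n) (hv : (n : ℤ) ^ d ≤ 2 * v) :
    C * (x : ℝ) ^ ((d : ℝ) * (1 - δ)) ≤ v := by
  have hx0 : (0 : ℝ) ≤ x := Nat.cast_nonneg _
  have h2C : (1 : ℝ) ≤ 2 * C := by linarith
  have hv' : ((n : ℝ)) ^ d ≤ 2 * (v : ℝ) := by exact_mod_cast hv
  have hnn : (0 : ℝ) ≤ 2 * C * (x : ℝ) ^ (1 - δ) := by positivity
  have h1 : (2 * C * (x : ℝ) ^ (1 - δ)) ^ d ≤ (n : ℝ) ^ d := pow_le_pow_left₀ hnn hn d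
  have h2 : (2 * C * (x : ℝ) ^ (1 - δ)) ^ d = (2 * C) ^ d * (x : ℝ) ^ ((d : ℝ) * (1 - δ)) := by
    rw [mul_pow, ← Real.rpow_natCast ((x : ℝ) ^ (1 - δ)) d, ← Real.rpow_mul hx0,
      mul_comm (1 - δ) (d : ℝ)]
  have h3 : 2 * C ≤ (2 * C) ^ d := le_self_pow₀ h2C (by omega)
  have hxpow : (0 : ℝ) ≤ (x : ℝ) ^ ((d : ℝ) * (1 - δ)) := Real.rpow_nonneg hx0 _
  rw [h2] at h1
  nlinarith [mul_le_mul_of_nonneg_right h3 hxpow]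

/-- Half exponents: for `x ≥ 1` and `0 ≤ a`, `x^{a/2} ≤ x^{a}` and `(x^{a/2})² = x^{a}`. [folklore] -/
theorem rpow_half_le_and_sq {x : ℕ} (hx : 1 ≤ x) {a : ℝ} (ha : 0 ≤ a) :
    (x : ℝ) ^ (a / 2) ≤ (x : ℝ) ^ a ∧ ((x : ℝ) ^ (a / 2)) ^ 2 = (x : ℝ) ^ a := by
  have hx1 : (1 : ℝ) ≤ x := by exact_mod_cast hx
  refine ⟨Real.rpow_le_rpow_of_exponent_le hx1 (by linarith), ?_⟩
  rw [← Real.rpow_natCast, ← Real.rpow_mul (by positivity)]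
  norm_num

/-- **Pointwise injection bound.**  With the uniform growth threshold `M` of
`exists_forall_pow_le_two_mul_eval`, every `1 ≤ n ≤ x` with `n ≥ M`, `n ≥ 2C·x^{1−δ}`, prime
spectator values `f_j(n)` (`j ≠ i`) and `f_i(n) = p·q`, `p ≤ q ≤ C·p` primes, lies in the layer
`coordLayer f i δ x` (`0 < δ ≤ 1`, `C ≥ 1`, degrees `≥ 1`). [folklore] -/
theorem mem_coordLayer_of_constantWindow {k : ℕ} (f : Fin k → ℤ[X]) (i : Fin k)
    (hdeg : ∀ j, 0 < (f j).natDegree) {M : ℕ}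
    (hM : ∀ j, ∀ n : ℕ, M ≤ n → (n : ℤ) ^ (f j).natDegree ≤ 2 * (f j).eval (n : ℤ))
    {δ C : ℝ} (hδ1 : δ ≤ 1) (hC : 1 ≤ C) {x n : ℕ} (hn1 : 1 ≤ n) (hnx : n ≤ x)
    (hnM : M ≤ n) (hnC : 2 * C * (x : ℝ) ^ (1 - δ) ≤ n)
    (hspec : ∀ j, j ≠ i → ((f j).eval (n : ℤ)).toNat.Prime)
    {p q : ℕ} (hp : p.Prime) (hq : q.Prime) (hpq : p ≤ q) (hqC : (q : ℝ) ≤ C * p)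
    (hval : (f i).eval (n : ℤ) = (p : ℤ) * q) :
    (∀ j, 0 < (f j).eval (n : ℤ) ∧
        ∀ p' ∈ range ⌈(x : ℝ) ^ (((f j).natDegree : ℝ) * (1 - δ) / 2)⌉₊,
          p'.Prime → ¬ ((p' : ℤ) ∣ (f j).eval (n : ℤ))) ∧
      ¬ ((f i).eval (n : ℤ)).toNat.Prime := by
  have hx : 1 ≤ x := hn1.trans hnx
  have hp0 : (0 : ℝ) ≤ p := Nat.cast_nonneg _
  -- the value of every coordinate is at least `C·x^{d_j(1-δ)}`
  have hbig : ∀ j, C * (x : ℝ) ^ (((f j).natDegree : ℝ) * (1 - δ)) ≤ (((f j).eval (n : ℤ) : ℤ) : ℝ) :=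
    fun j => const_mul_rpow_le_of_pow_le (hdeg j) hC hnC (hM j n hnM)
  have hexp : ∀ j, (0 : ℝ) ≤ ((f j).natDegree : ℝ) * (1 - δ) := fun j =>
    mul_nonneg (Nat.cast_nonneg _) (by linarith)
  refine ⟨fun j => ?_, ?_⟩
  · by_cases hji : j = i
    · subst hji
      have hpos : 0 < (f j).eval (n : ℤ) := by
        rw [hval]; exact_mod_cast Nat.mul_pos hp.pos hq.pos
      refine ⟨hpos, fun p' hp' hp'p hdvd => ?_⟩
      have hlt : (p' : ℝ) < (x : ℝ) ^ (((f j).natDegree : ℝ) * (1 - δ) / 2) :=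
        Nat.lt_ceil.mp (mem_range.mp hp')
      -- `p ≥ x^{d(1-δ)/2}` from `C x^{d(1-δ)} ≤ p q ≤ C p²`
      obtain ⟨-, hsq⟩ := rpow_half_le_and_sq hx (hexp j)
      have hz0 : (0 : ℝ) ≤ (x : ℝ) ^ (((f j).natDegree : ℝ) * (1 - δ) / 2) :=
        Real.rpow_nonneg (Nat.cast_nonneg _) _
      have hpq_le : (((f j).eval (n : ℤ) : ℤ) : ℝ) ≤ C * (p : ℝ) ^ 2 := by
        rw [hval]; push_cast; nlinarith
      have hzp : (x : ℝ) ^ (((f j).natDegree : ℝ) * (1 - δ) / 2) ≤ p := by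
        by_contra hcon
        push Not at hcon
        have h1 : (p : ℝ) ^ 2 < ((x : ℝ) ^ (((f j).natDegree : ℝ) * (1 - δ) / 2)) ^ 2 := by
          nlinarith [mul_pos (sub_pos.2 hcon) (add_pos_of_nonneg_of_pos hp0 (hp0.trans_lt hcon))]
        have h2 := hbig j
        rw [hsq] at h1
        nlinarith
      -- `p' ∣ p q` forces `p' ∈ {p, q}`, both `≥ x^{d(1-δ)/2} > p'`
      have hdvd' : p' ∣ p * q := by
        rw [hval] at hdvd; exact_mod_cast hdvd
      rcases (Nat.Prime.dvd_mul hp'p).mp hdvd' with h | h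
      · have := (Nat.prime_dvd_prime_iff_eq hp'p hp).mp h
        subst this; linarith
      · have := (Nat.prime_dvd_prime_iff_eq hp'p hq).mp h
        subst this
        have : (p : ℝ) ≤ p' := by exact_mod_cast hpq
        linarith
    · have hprime := hspec j hji
      have hpos : 0 < (f j).eval (n : ℤ) := by
        by_contra hle
        push Not at hle
        rw [Int.toNat_of_nonpos hle] at hprime
        exact Nat.not_prime_zero hprime
      refine ⟨hpos, fun p' hp' hp'p hdvd => ?_⟩
      have hlt : (p' : ℝ) < (x : ℝ) ^ (((f j).natDegree : ℝ) * (1 - δ) / 2) :=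
        Nat.lt_ceil.mp (mem_range.mp hp')
      have hcast : (((f j).eval (n : ℤ)).toNat : ℤ) = (f j).eval (n : ℤ) :=
        Int.toNat_of_nonneg hpos.le
      have hdvd' : p' ∣ ((f j).eval (n : ℤ)).toNat := by
        rw [← hcast] at hdvd; exact_mod_cast hdvd
      have heq : p' = ((f j).eval (n : ℤ)).toNat := (Nat.prime_dvd_prime_iff_eq hp'p hprime).mp hdvd'
      have hval' : (((f j).eval (n : ℤ) : ℤ) : ℝ) = (p' : ℝ) := by
        rw [heq]; exact_mod_cast hcast.symm
      obtain ⟨hhalf, -⟩ := rpow_half_le_and_sq hx (hexp j)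
      have h2 := hbig j
      have hxp : (0 : ℝ) ≤ (x : ℝ) ^ (((f j).natDegree : ℝ) * (1 - δ)) :=
        Real.rpow_nonneg (Nat.cast_nonneg _) _
      nlinarith
  · rw [hval]
    have : (((p : ℤ) * q).toNat) = p * q := by
      rw [show ((p : ℤ) * q) = ((p * q : ℕ) : ℤ) by push_cast; ring, Int.toNat_natCast]
    rw [this, Nat.prime_mul_iff]
    rintro (⟨-, h1⟩ | ⟨-, h1⟩)
    · exact hq.ne_one h1
    · exact hp.ne_one h1

/-- **Counting form.**  For every `x`:
`#(constant window) ≤ coordLayer f i δ x + (M + 2C·x^{1−δ} + 1)`. [folklore] -/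
theorem card_constantWindow_le {k : ℕ} (f : Fin k → ℤ[X]) (i : Fin k)
    (hdeg : ∀ j, 0 < (f j).natDegree) {M : ℕ}
    (hM : ∀ j, ∀ n : ℕ, M ≤ n → (n : ℤ) ^ (f j).natDegree ≤ 2 * (f j).eval (n : ℤ))
    {δ C : ℝ} (hδ1 : δ ≤ 1) (hC : 1 ≤ C) (x : ℕ) :
    (#((Icc 1 x).filter fun n : ℕ =>
        (∀ j, j ≠ i → ((f j).eval (n : ℤ)).toNat.Prime) ∧
          ∃ p q : ℕ, p.Prime ∧ q.Prime ∧ p ≤ q ∧ (q : ℝ) ≤ C * p ∧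
            (f i).eval (n : ℤ) = (p : ℤ) * q) : ℝ) ≤
      (coordLayer f i δ x : ℝ) + ((M : ℝ) + 2 * C * (x : ℝ) ^ (1 - δ) + 1) := by
  set T : ℝ := 2 * C * (x : ℝ) ^ (1 - δ) with hT
  have hC0 : 0 < C := by linarith
  have hT0 : 0 ≤ T := by rw [hT]; positivity
  set S := (Icc 1 x).filter fun n : ℕ =>
        (∀ j, j ≠ i → ((f j).eval (n : ℤ)).toNat.Prime) ∧
          ∃ p q : ℕ, p.Prime ∧ q.Prime ∧ p ≤ q ∧ (q : ℝ) ≤ C * p ∧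
            (f i).eval (n : ℤ) = (p : ℤ) * q with hS
  -- split `S` at the threshold `small n := n < M ∨ n < T`
  have hsplit := Finset.card_filter_add_card_filter_not
    (s := S) (fun n : ℕ => n < M ∨ (n : ℝ) < T)
  -- small part: contained in `range (M + ⌈T⌉₊)`
  have hsmall : #(S.filter fun n : ℕ => n < M ∨ (n : ℝ) < T) ≤ M + ⌈T⌉₊ := by
    calc #(S.filter fun n : ℕ => n < M ∨ (n : ℝ) < T)
        ≤ #(range (M + ⌈T⌉₊)) := by
          refine card_le_card fun n hn => ?_
          rw [mem_filter] at hn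
          rw [mem_range]
          rcases hn.2 with h | h
          · omega
          · have := Nat.lt_ceil.mpr h
            omega
      _ = M + ⌈T⌉₊ := card_range _
  -- large part: inside the layer
  have hlarge : #(S.filter fun n : ℕ => ¬ (n < M ∨ (n : ℝ) < T)) ≤ coordLayer f i δ x := by
    rw [coordLayer]
    refine card_le_card fun n hn => ?_
    rw [mem_filter] at hn
    obtain ⟨hnS, hnl⟩ := hn
    push Not at hnl
    rw [hS, mem_filter, mem_Icc] at hnS
    obtain ⟨⟨hn1, hnx⟩, hspec, p, q, hp, hq, hpq, hqC, hval⟩ := hnS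
    rw [mem_filter, mem_Icc]
    exact ⟨⟨hn1, hnx⟩, mem_coordLayer_of_constantWindow f i hdeg hM hδ1 hC hn1 hnx hnl.1
      (by rw [hT] at hnl; exact hnl.2) hspec hp hq hpq hqC hval⟩
  have hceil : (⌈T⌉₊ : ℝ) < T + 1 := Nat.ceil_lt_add_one hT0
  have hcard : (#S : ℝ) = #(S.filter fun n : ℕ => n < M ∨ (n : ℝ) < T) +
      #(S.filter fun n : ℕ => ¬ (n < M ∨ (n : ℝ) < T)) := by
    rw [← hsplit]; push_cast; ring
  rw [hcard]
  have h1 : (#(S.filter fun n : ℕ => n < M ∨ (n : ℝ) < T) : ℝ) ≤ M + ⌈T⌉₊ := by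
    exact_mod_cast hsmall
  have h2 : (#(S.filter fun n : ℕ => ¬ (n < M ∨ (n : ℝ) < T)) : ℝ) ≤ coordLayer f i δ x := by
    exact_mod_cast hlarge
  linarith

/-- **The constant-window consequence of a thin coordinate layer.**  If `CoordLayerThin f i` (degrees
`≥ 1`, positive leading coefficients), then for every `C ≥ 1` and `ε > 0`, eventually
`#{1 ≤ n ≤ x : f_j(n) prime (j ≠ i), f_i(n) = p·q, p ≤ q ≤ C·p primes} ≤ ε·x/(log x)^k`. [folklore] -/
theorem constantWindow_thin_of_coordLayerThin {k : ℕ} (f : Fin k → ℤ[X]) (i : Fin k)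
    (hlc : ∀ j, 0 < (f j).leadingCoeff) (hdeg : ∀ j, 0 < (f j).natDegree)
    (h : CoordLayerThin f i) {C : ℝ} (hC : 1 ≤ C) {ε : ℝ} (hε : 0 < ε) :
    ∀ᶠ x : ℕ in atTop,
      (#((Icc 1 x).filter fun n : ℕ =>
          (∀ j, j ≠ i → ((f j).eval (n : ℤ)).toNat.Prime) ∧
            ∃ p q : ℕ, p.Prime ∧ q.Prime ∧ p ≤ q ∧ (q : ℝ) ≤ C * p ∧
              (f i).eval (n : ℤ) = (p : ℤ) * q) : ℝ) ≤ ε * x / Real.log x ^ k := by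
  obtain ⟨δ, hδ0, hδ4, hev⟩ := h (ε / 2) (half_pos hε)
  obtain ⟨M, hM⟩ := exists_forall_pow_le_two_mul_eval f hlc
  have hC0 : 0 < 2 * C := by linarith
  have hε' : 0 < ε / 2 / (2 * C) := by positivity
  have hsmall := eventually_const_add_rpow_le hδ0 (by linarith) hε' (((M : ℝ) + 1) / (2 * C)) k
  filter_upwards [hev, hsmall] with x hx hs
  have hbound := card_constantWindow_le f i hdeg hM (by linarith : δ ≤ 1) hC x
  -- rescale the small-`n` estimate by `2C`
  have hs' : (M : ℝ) + 2 * C * (x : ℝ) ^ (1 - δ) + 1 ≤ ε / 2 * x / Real.log x ^ k := by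
    have := mul_le_mul_of_nonneg_left hs hC0.le
    have e1 : 2 * C * (((M : ℝ) + 1) / (2 * C) + (x : ℝ) ^ (1 - δ)) =
        (M : ℝ) + 2 * C * (x : ℝ) ^ (1 - δ) + 1 := by field_simp; ring
    have e2 : 2 * C * (ε / 2 / (2 * C) * (x : ℝ) / Real.log x ^ k) =
        ε / 2 * x / Real.log x ^ k := by field_simp
    linarith [e1, e2]
  have e3 : ε / 2 * (x : ℝ) / Real.log x ^ k + ε / 2 * x / Real.log x ^ k =
      ε * x / Real.log x ^ k := by ring
  linarith

/-- **From the crux BY NAME.**  `BalancedSemiprimeLayer` implies, for every Bateman–Horn system `f`,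
every coordinate `i`, every `C ≥ 1` and `ε > 0`: eventually
`#{1 ≤ n ≤ x : f_j(n) prime (j ≠ i), f_i(n) = p·q, p ≤ q ≤ C·p primes} ≤ ε·x/(log x)^k` — the
constant-window balanced two-prime values of a coordinate (with prime spectators) are `o(x/(log x)^k)`.
(Necessary for the crux, hence for `LayerHigher`; open for `deg f_i ≥ 3`.) [folklore] -/
theorem constantWindow_thin_of_balancedSemiprimeLayer (h : BalancedSemiprimeLayer)
    {k : ℕ} (f : Fin k → ℤ[X]) (hf : IsBatemanHornSystem f) (i : Fin k)
    {C : ℝ} (hC : 1 ≤ C) {ε : ℝ} (hε : 0 < ε) :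
    ∀ᶠ x : ℕ in atTop,
      (#((Icc 1 x).filter fun n : ℕ =>
          (∀ j, j ≠ i → ((f j).eval (n : ℤ)).toNat.Prime) ∧
            ∃ p q : ℕ, p.Prime ∧ q.Prime ∧ p ≤ q ∧ (q : ℝ) ≤ C * p ∧
              (f i).eval (n : ℤ) = (p : ℤ) * q) : ℝ) ≤ ε * x / Real.log x ^ k :=
  constantWindow_thin_of_coordLayerThin f i hf.leadingCoeff_pos
    (natDegree_pos_of_isBatemanHornSystem hf) (coordLayerThin_of_balancedSemiprimeLayer h f hf i) hC hε

/-- **From the registered residual stub verbatim.**  `LayerHigher` (the statement of `stub_higherLayer`: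
thin layers for all coordinates of degree `≥ 3` of every Bateman–Horn system) implies the constant-window
bound for EVERY coordinate of every Bateman–Horn system (degrees `≤ 2` being the landed
`Split.coordLayerThin_of_natDegree_le_two`). [folklore] -/
theorem constantWindow_thin_of_higherLayer
    (hhigh : ∀ (k : ℕ) (f : Fin k → ℤ[X]), IsBatemanHornSystem f →
      ∀ i : Fin k, 3 ≤ (f i).natDegree → CoordLayerThin f i)
    {k : ℕ} (f : Fin k → ℤ[X]) (hf : IsBatemanHornSystem f) (i : Fin k)
    {C : ℝ} (hC : 1 ≤ C) {ε : ℝ} (hε : 0 < ε) :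
    ∀ᶠ x : ℕ in atTop,
      (#((Icc 1 x).filter fun n : ℕ =>
          (∀ j, j ≠ i → ((f j).eval (n : ℤ)).toNat.Prime) ∧
            ∃ p q : ℕ, p.Prime ∧ q.Prime ∧ p ≤ q ∧ (q : ℝ) ≤ C * p ∧
              (f i).eval (n : ℤ) = (p : ℤ) * q) : ℝ) ≤ ε * x / Real.log x ^ k :=
  constantWindow_thin_of_coordLayerThin f i hf.leadingCoeff_pos
    (natDegree_pos_of_isBatemanHornSystem hf)
    (Split.coordLayerThin_of_higherLayer_system hf (hhigh k f hf) i) hC hε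

/-- **Unconditional in degree `≤ 2`.**  For a Bateman–Horn system `f` and a coordinate `i` with
`deg f_i ≤ 2`, for every `C ≥ 1` and `ε > 0`: eventually
`#{1 ≤ n ≤ x : f_j(n) prime (j ≠ i), f_i(n) = p·q, p ≤ q ≤ C·p primes} ≤ ε·x/(log x)^k`
(through the landed linear and quadratic layers, `Split.coordLayerThin_of_natDegree_le_two` p83112; e.g.
`n² + 1`, or the twin system `(X, X + 2)`). [folklore] -/
theorem constantWindow_thin_of_natDegree_le_two {k : ℕ} (f : Fin k → ℤ[X])
    (hf : IsBatemanHornSystem f) (i : Fin k) (hi : (f i).natDegree ≤ 2)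
    {C : ℝ} (hC : 1 ≤ C) {ε : ℝ} (hε : 0 < ε) :
    ∀ᶠ x : ℕ in atTop,
      (#((Icc 1 x).filter fun n : ℕ =>
          (∀ j, j ≠ i → ((f j).eval (n : ℤ)).toNat.Prime) ∧
            ∃ p q : ℕ, p.Prime ∧ q.Prime ∧ p ≤ q ∧ (q : ℝ) ≤ C * p ∧
              (f i).eval (n : ℤ) = (p : ℤ) * q) : ℝ) ≤ ε * x / Real.log x ^ k :=
  constantWindow_thin_of_coordLayerThin f i hf.leadingCoeff_pos
    (natDegree_pos_of_isBatemanHornSystem hf)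
    (Split.coordLayerThin_of_natDegree_le_two k f hf i hi) hC hε

end Summit.Parity.BatemanHorn.Cruxes.BalancedSemiprimeLayer.SmoothModulusTwistedHooley.ConstantWindow

/-! ### The registered bookkeeping stub (crux stmt-Parity-9469, skeleton `Lines/smooth_modulus_twisted_hooley.lean`) -/

namespace Summit.Parity.BatemanHorn.Cruxes.BalancedSemiprimeLayer.SmoothModulusTwistedHooley

open Polynomial Filter Finset
open scoped Classical
open Literature.NumberTheory.Sieve

/-- **stub_constantWindowOfHigherLayer** (registered bookkeeping stub of crux stmt-Parity-9469, lead seat c14;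
not used by the composition `BalancedSemiprimeLayer_of`).  The statement of the residual stub
`stub_higherLayer` (= `LayerHigher`), taken as a HYPOTHESIS, implies the constant-window bound for every
coordinate of every Bateman–Horn system: for `C ≥ 1`, `ε > 0`, eventually
`#{1 ≤ n ≤ x : f_j(n) prime (j ≠ i), f_i(n) = p·q, p ≤ q ≤ C·p primes} ≤ ε·x/(log x)^k`
(`ConstantWindow.constantWindow_thin_of_higherLayer`). [folklore] -/
theorem stub_constantWindowOfHigherLayer :
    (∀ (k : ℕ) (f : Fin k → ℤ[X]), IsBatemanHornSystem f →
        ∀ i : Fin k, 3 ≤ (f i).natDegree → CoordLayerThin f i) →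
      ∀ (k : ℕ) (f : Fin k → ℤ[X]), IsBatemanHornSystem f → ∀ (i : Fin k) (C : ℝ), 1 ≤ C →
        ∀ ε : ℝ, 0 < ε → ∀ᶠ x : ℕ in atTop,
          (#((Icc 1 x).filter fun n : ℕ =>
              (∀ j, j ≠ i → ((f j).eval (n : ℤ)).toNat.Prime) ∧
                ∃ p q : ℕ, p.Prime ∧ q.Prime ∧ p ≤ q ∧ (q : ℝ) ≤ C * p ∧
                  (f i).eval (n : ℤ) = (p : ℤ) * q) : ℝ) ≤ ε * x / Real.log x ^ k :=
  fun hhigh _k f hf i _C hC _ε hε =>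
    ConstantWindow.constantWindow_thin_of_higherLayer hhigh f hf i hC hε

end Summit.Parity.BatemanHorn.Cruxes.BalancedSemiprimeLayer.SmoothModulusTwistedHooley

end
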